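import Literature.AlgebraicGeometry.Motives.HirschowitzIyerRuledSurface
import Literature.AlgebraicGeometry.Motives.HypersurfaceLinearSections
import Literature.AlgebraicGeometry.Motives.CartierDivisorGysinProjective
import HarnessLib

/-!
# The ruled surface of Hirschowitz–Iyer's Lemma 2.2 (`s = 0`), II: the hyperplane section and the principal divisor along the generic fibre

Hirschowitz–Iyer 2010, proof of Lemma 2.2: "So now we compute `H'_Z · (Z × Y)`. This is the divisor
class in `H'_Z` defined by the linear system `|pr₂^* 𝒪_{Y'}(Y)|`. Now `H'_Z` is a projective bundle
and this linear system has degree `d` along the fibers of this bundle. Thus we have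
`H'_Z · (Z × Y) = d H_Z + ψ⁻¹(D)` where `D` is a divisor in `Z`." On the ruled surface
`S ⊆ ℙ⁸ ×_K Z` of `Motives/HirschowitzIyerRuledSurface` (closure of the generic strong line, with
marked points `σ̃` — the section over `W` — and `τ̃` — the hyperplane section `x_{c₀} = 0` of the
generic fibre) this file proves the two facts about HORIZONTAL components that the tree's Chow
calculus needs, in elementary form (no degree theory on projective bundles):

* `hyperplaneInter` — the `1`-cycle `E = V₊(x_{c₀})|_{V₊(Q)} · [S]` on `S` (the pull-back of the
  hyperplane-section divisor `H_m` of the quadric along `π : S → V₊(Q)`, intersected with `[S]`);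
  `hyperplaneInter_apply_eq_zero_of_horizontal` — **its only horizontal component is `τ̃`** (a
  horizontal point with non-zero coefficient lies on `V₊(m)`, hence is the point `τ` of the generic
  line, `Fulton`'s positivity `primeInter_pos_of_not_avoids` on the line); `hyperplaneInter_τS_pos` —
  **`τ̃` does occur** (positivity again, on `S`);
* `exists_ord_eq_horizontal` — **`[σ̃] - [τ̃] = [div g̃] + (vertical)`**: a rational function
  `g̃ ∈ K(S)ˣ` whose divisor agrees with `[σ̃] - [τ̃]` at all horizontal points (the function `g` of
  the generic fibre with `[σ] - [τ] = [div g]` on the line, `LinePencilData.exists_ord_eq`, spread by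
  `GenericFibreRatSpread.divFun_image_ι_apply`).

## References

* A. Hirschowitz, J. N. N. Iyer, Contemp. Math. 522 (2010), arXiv:0903.5018, §2 Lemma 2.2 (proof).
  [HirschowitzIyer2010]
* W. Fulton, *Intersection Theory* (1998), §1.3, Def. 2.3, §2.3. [Fulton1998]
-/

noncomputable section

open CategoryTheory CategoryTheory.Limits AlgebraicGeometry Order MonoidalCategory IsLocalRing MvPolynomial
open Literature.AlgebraicGeometry.Motives.Segre

universe u

namespace Literature.AlgebraicGeometry.Motives

attribute [local instance] MvPolynomial.gradedAlgebra

namespace GenericStrongLine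

open ProjBaseChangeRing StrongLineCover

variable {K : Type u} [Field K] [Infinite K] {Q C : MvPolynomial (Fin (8 + 1)) K}
  {w : ↥(quadricCubic Q C).left} (𝔏 : GenericStrongLine Q C w)

/-! ### The hyperplane `x_{c₀} = 0` -/

/-- The linear form `m = x_{c₀}` over `K`. [folklore] -/
abbrev mK : MvPolynomial (Fin (8 + 1)) K := X 𝔏.c₀

omit [Infinite K] in
/-- Bookkeeping. [folklore] -/
theorem mK_mem : 𝔏.mK ∈ grading (Fin (8 + 1)) K 1 := ProjectiveSpace.X_mem 𝔏.c₀

omit [Infinite K] in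
/-- Bookkeeping. [folklore] -/
theorem mK_ne_zero : 𝔏.mK ≠ 0 := X_ne_zero _

omit [Infinite K] in
/-- Bookkeeping. [folklore] -/
theorem map_mK : MvPolynomial.map (algebraMap K 𝔏.Kz) 𝔏.mK = 𝔏.lineData.m := by
  rw [mK, map_X]; rfl

omit [Infinite K] in
/-- `m(p) ≠ 0`: `m ∉ 𝔭_{w}` (through `ℙ⁸`). [folklore] -/
theorem mK_notMem_w : 𝔏.mK ∉ ProjectiveSpectrum.asHomogeneousIdeal
    (𝒜 := MvPolynomial.homogeneousSubmodule (Fin (8 + 1)) K) ((completeIntersectionι ![Q, C]).left w) := by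
  intro h
  have hpt : (completeIntersectionι ![Q, C]).left w = (ProjectiveSpace.pointOfVec K 𝔏.p 𝔏.hp).pt := by
    rw [𝔏.hP, AlgPoints.pt_map, genericAlgPoint_pt]
  rw [hpt] at h
  have hmem : (ProjectiveSpace.pointOfVec K 𝔏.p 𝔏.hp).pt ∈
      ProjectiveSpectrum.zeroLocus (MvPolynomial.homogeneousSubmodule (Fin (8 + 1)) K) {𝔏.mK} :=
    (ProjectiveSpectrum.mem_zeroLocus _ _ _).mpr (Set.singleton_subset_iff.mpr h)
  have h' := (ProjectiveSpace.pt_pointOfVec_mem_zeroLocus_iff 𝔏.p 𝔏.hp one_pos 𝔏.mK_mem).mp hmem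
  rw [mK, aeval_X] at h'
  exact ProjectiveSpace.apply_firstNe_ne_zero 𝔏.p 𝔏.hp h'

variable [IsIntegral (quadric Q).left]

omit [Infinite K] in
/-- Homogeneous primes grow along specialisations of `ℙ⁸`. [folklore] -/
theorem _root_.Literature.AlgebraicGeometry.Motives.asHomogeneousIdeal_le_of_specializes {R : Type u} [CommRing R]
    {n : ℕ} {x y : ↥(Proj (MvPolynomial.homogeneousSubmodule (Fin (n + 1)) R))} (h : x ⤳ y) :
    ProjectiveSpectrum.asHomogeneousIdeal (𝒜 := MvPolynomial.homogeneousSubmodule (Fin (n + 1)) R) x ≤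
      ProjectiveSpectrum.asHomogeneousIdeal (𝒜 := MvPolynomial.homogeneousSubmodule (Fin (n + 1)) R) y := by
  have hle : @LE.le (ProjectiveSpectrum (MvPolynomial.homogeneousSubmodule (Fin (n + 1)) R)) _ x y :=
    (ProjectiveSpectrum.le_iff_mem_closure (MvPolynomial.homogeneousSubmodule (Fin (n + 1)) R) x y).mpr
      h.mem_closure
  exact hle

omit [Infinite K] in
/-- `m` does not vanish at the generic point of the quadric. [folklore] -/
theorem formDivisor_mK_avoids_genericPoint :
    (ProjSpace.formDivisor 𝔏.mK 𝔏.mK_mem 𝔏.mK_ne_zero).Avoids (quadricι Q (genericPoint (quadric Q).left)) := by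
  refine (ProjSpace.formDivisor_avoids_iff 𝔏.mK_mem 𝔏.mK_ne_zero zero_lt_one).mpr fun h => 𝔏.mK_notMem_w ?_
  have hsp : quadricι Q (genericPoint (quadric Q).left) ⤳ quadricι Q ((quadricCubicToQuadric Q C).left w) :=
    ((genericPoint_spec (quadric Q).left).specializes (Set.mem_univ _)).map (quadricι Q).continuous
  have e1 : (completeIntersectionι ![Q, C]).left w = iQ (Q := Q) ((quadricCubicToQuadric Q C).left w) := by
    rw [← Scheme.Hom.comp_apply, ← Over.comp_left, quadricCubicToQuadric_ι]
  have e1' : (completeIntersectionι ![Q, C]).left w = quadricι Q ((quadricCubicToQuadric Q C).left w) := e1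
  rw [e1']
  exact asHomogeneousIdeal_le_of_specializes hsp h

/-- **The hyperplane-section divisor `H_m = V₊(x_{c₀})|_{V₊(Q)}`** of the quadric. [folklore] -/
def Hm : CartierDivisor (quadric Q).left :=
  (ProjSpace.formDivisor 𝔏.mK 𝔏.mK_mem 𝔏.mK_ne_zero).pullbackAvoiding (quadricι Q) 𝔏.formDivisor_mK_avoids_genericPoint

omit [Infinite K] in
/-- `H_m` is effective. [folklore] -/
theorem isEffective_Hm : (𝔏.Hm).IsEffective :=
  (ProjSpace.isEffective_formDivisor 𝔏.mK_mem 𝔏.mK_ne_zero).pullbackAvoiding _ _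

omit [Infinite K] in
/-- `H_m` avoids `x` iff `m ∉ 𝔭_x`. [folklore] -/
theorem Hm_avoids_iff (x : ↥(quadric Q).left) : (𝔏.Hm).Avoids x ↔
    𝔏.mK ∉ ProjectiveSpectrum.asHomogeneousIdeal (𝒜 := MvPolynomial.homogeneousSubmodule (Fin (8 + 1)) K) (quadricι Q x) :=
  ProjSpace.avoids_pullbackAvoiding_formDivisor_iff (quadricι Q) zero_lt_one 𝔏.mK_mem 𝔏.mK_ne_zero _ x

/-! ### The hyperplane section of `S` -/

variable [IsAlgClosed K]

/-- `S` (the carrier) is locally of finite type over `K`. [folklore] -/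
instance locallyOfFiniteType_So_hom : LocallyOfFiniteType (𝔏.So).hom := by
  change LocallyOfFiniteType ((𝔏.S).ι ≫ ((projectiveSpace 8 K) ⊗ 𝔏.Z).hom)
  infer_instance

/-- The quadric is locally of finite type over `K`. [folklore] -/
instance locallyOfFiniteType_quadric_hom' : LocallyOfFiniteType (quadric Q).hom := inferInstance

/-- **The `1`-cycle `E = H_m · [S]` on `S`** (`= [π^* H_m]`, the Weil divisor of the pulled-back
hyperplane section; HI's `H'_Z · (Z × Y)` up to the factor `d = 3` and the passage `Y ↦ H_m`).
[cite: HirschowitzIyer2010, §2 Lemma 2.2 (proof)] -/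
def hyperplaneInter : AlgebraicCycle (𝔏.S).carrier ℤ :=
  ((𝔏.Hm).pullbackRep (𝔏.πq).left).primeInter (X := 𝔏.So) (genericPoint (𝔏.S).carrier)

omit [IsIntegral (quadric Q).left] [IsAlgClosed K] in
/-- A point of `S` over the generic point of `Z` ("horizontal") comes from the generic line.
[folklore] -/
theorem exists_toImage_eq_of_horizontal {s : (𝔏.S).carrier}
    (hs : (CartesianMonoidalCategory.snd (projectiveSpace 8 K) 𝔏.Z).left ((𝔏.S).ι s) = genericPoint (𝔏.Z).left) :
    ∃ y : 𝔏.lineData.lineSub.carrier, 𝔏.lineData.lineSub.toImage (genFibι w (𝔏.F' : Type u)) y = s := by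
  refine exists_toImage_apply_eq (X := projectiveSpace 8 K) (T := 𝔏.Z) (isPullback_genFibι w (𝔏.F' : Type u))
    𝔏.lineData.lineSub s ?_
  rw [range_fromSpecStalk_genericPoint]
  exact hs

omit [IsIntegral (quadric Q).left] [IsAlgClosed K] in
/-- `pr₁` of a point of the generic line is `Proj.map` of it. [folklore] -/
theorem prS_toImage (y : 𝔏.lineData.lineSub.carrier) :
    𝔏.prS (𝔏.lineData.lineSub.toImage (genFibι w (𝔏.F' : Type u)) y) =
      Proj.map (mapGraded K 𝔏.Kz (Fin (8 + 1))) (irrelevant_le_map K 𝔏.Kz (Fin (8 + 1))) (𝔏.lineData.lineSub.ι y) := by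
  change (CartesianMonoidalCategory.fst (projectiveSpace 8 K) 𝔏.Z).left
    ((𝔏.S).ι (𝔏.lineData.lineSub.toImage (genFibι w (𝔏.F' : Type u)) y)) = _
  have h : (𝔏.S).ι (𝔏.lineData.lineSub.toImage (genFibι w (𝔏.F' : Type u)) y) =
      genFibι w (𝔏.F' : Type u) (𝔏.lineData.lineSub.ι y) :=
    (ι_apply_eq_image_ι_toImage _ _).symm
  rw [h, ← Scheme.Hom.comp_apply, genFibι_fst]
  rfl

omit [IsIntegral (quadric Q).left] [IsAlgClosed K] in
/-- A non-generic point of the line has height `0`. [folklore] -/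
theorem height_ι_eq_zero_of_ne {y : 𝔏.lineData.lineSub.carrier}
    (hy : 𝔏.lineData.lineSub.ι y ≠ 𝔏.lineData.γ) : height (𝔏.lineData.lineSub.ι y) = 0 := by
  have hmem : 𝔏.lineData.lineSub.ι y ∈ Set.range 𝔏.lineData.lineSub.ι := ⟨y, rfl⟩
  rw [𝔏.lineData.range_lineSub_ι] at hmem
  have hlt := height_lt_of_mem_zeroLocus 𝔏.lineData.Λ 𝔏.lineData.Λ_linearIndependent 𝔏.lineData.Λ_isHomogeneous
    (by norm_num) hmem hy
  have hlt' : height (𝔏.lineData.lineSub.ι y) < 1 := by simpa using hlt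
  exact Order.lt_one_iff.mp hlt'

omit [IsAlgClosed K] in
/-- **The horizontal part of `E` is supported at `τ̃`**: a horizontal point `s ≠ τ̃` has
coefficient `0` (if the coefficient were non-zero, `m` would vanish at `pr₁ s`, a point of the
generic line of height `0`, forcing `pr₁ s = τ`). [cite: HirschowitzIyer2010, §2 Lemma 2.2 (proof)]
[cite: Fulton1998, Def. 2.3] -/
theorem hyperplaneInter_apply_eq_zero_of_horizontal (hw : height w = 1) {s : (𝔏.S).carrier}
    (hs : (CartesianMonoidalCategory.snd (projectiveSpace 8 K) 𝔏.Z).left ((𝔏.S).ι s) = genericPoint (𝔏.Z).left)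
    (hsτ : s ≠ τS w (𝔏.F' : Type u) 𝔏.lineData) : 𝔏.hyperplaneInter s = 0 := by
  by_contra hne
  -- `s` has height `1` (it carries a non-zero coefficient of a `1`-cycle)
  have hE1 : 𝔏.hyperplaneInter ∈ cyclesOfDim (𝔏.S).carrier 1 :=
    CartierDivisor.primeInter_mem_cyclesOfDim (X := 𝔏.So) _
      (height_genericPoint_surf_carrier w (𝔏.F' : Type u) 𝔏.lineData hw)
  have hs1 : height s = 1 := by exact_mod_cast hE1 s hne
  -- `m` vanishes at `pr₁ s`
  have hav : ¬ ((𝔏.Hm).pullbackRep (𝔏.πq).left).Avoids s := fun h =>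
    hne (CartierDivisor.primeInter_apply_eq_zero_of_avoids (X := 𝔏.So) _ _ h)
  have hm : 𝔏.mK ∈ ProjectiveSpectrum.asHomogeneousIdeal
      (𝒜 := MvPolynomial.homogeneousSubmodule (Fin (8 + 1)) K) (quadricι Q ((𝔏.πq).left s)) := by
    by_contra h
    exact hav (CartierDivisor.Avoids.pullbackRep ((𝔏.Hm_avoids_iff _).mpr h))
  -- `s` comes from a point `y` of the line, of height `0`, at which `m` vanishes: `y = τ'`
  obtain ⟨y, rfl⟩ := 𝔏.exists_toImage_eq_of_horizontal hs
  rw [quadricι_πq, prS_toImage] at hm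
  have hm' : 𝔏.lineData.m ∈ ProjectiveSpectrum.asHomogeneousIdeal
      (𝒜 := MvPolynomial.homogeneousSubmodule (Fin (8 + 1)) 𝔏.Kz) (𝔏.lineData.lineSub.ι y) := by
    rw [← map_mK]; exact (ProjectiveSpectrum.mem_asHomogeneousIdeal_map_iff _ _).mp hm
  have hyγ : 𝔏.lineData.lineSub.ι y ≠ 𝔏.lineData.γ := fun h => 𝔏.lineData.m_notMem_γ (h ▸ hm')
  have hy0 : height (𝔏.lineData.lineSub.ι y) = 0 := 𝔏.height_ι_eq_zero_of_ne hyγ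
  have hpos : 0 < 𝔏.lineData.H.primeInter (X := projectiveSpace 8 𝔏.Kz) 𝔏.lineData.γ (𝔏.lineData.lineSub.ι y) := by
    refine CartierDivisor.primeInter_pos_of_not_avoids (X := projectiveSpace 8 𝔏.Kz)
      (ProjSpace.isEffective_formDivisor _ _) ?_ ?_ ?_ ?_
    · exact (ProjSpace.formDivisor_avoids_iff _ _ zero_lt_one).mpr 𝔏.lineData.m_notMem_γ
    · have hmem : 𝔏.lineData.lineSub.ι y ∈ Set.range 𝔏.lineData.lineSub.ι := ⟨y, rfl⟩
      rw [𝔏.lineData.range_lineSub_ι, ← 𝔏.lineData.closure_γ] at hmem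
      exact specializes_iff_mem_closure.mpr hmem
    · rw [hy0, 𝔏.lineData.height_γ]; rfl
    · exact fun h => ((ProjSpace.formDivisor_avoids_iff _ _ zero_lt_one).mp h) hm'
  rw [𝔏.lineData.primeInter_γ] at hpos
  have hyτ : 𝔏.lineData.lineSub.ι y = 𝔏.lineData.τ := by
    by_contra h
    rw [primeCycle_apply_of_ne h] at hpos
    exact lt_irrefl _ hpos
  apply hsτ
  have : y = 𝔏.lineData.τ' := 𝔏.lineData.lineSub.ι_base_injective (by rw [hyτ]; rfl)
  rw [this]; rfl

omit [IsIntegral (quadric Q).left] [IsAlgClosed K] in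
/-- `pr₁ τ̃ = Proj.map τ`, so `m` vanishes at `π τ̃`. [folklore] -/
theorem mK_mem_πq_τS : 𝔏.mK ∈ ProjectiveSpectrum.asHomogeneousIdeal
    (𝒜 := MvPolynomial.homogeneousSubmodule (Fin (8 + 1)) K) (quadricι Q ((𝔏.πq).left (τS w (𝔏.F' : Type u) 𝔏.lineData))) := by
  rw [quadricι_πq]
  change 𝔏.mK ∈ ProjectiveSpectrum.asHomogeneousIdeal (𝒜 := MvPolynomial.homogeneousSubmodule (Fin (8 + 1)) K)
    (𝔏.prS (𝔏.lineData.lineSub.toImage (genFibι w (𝔏.F' : Type u)) 𝔏.lineData.τ'))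
  rw [prS_toImage]
  refine (ProjectiveSpectrum.mem_asHomogeneousIdeal_map_iff _ _).mpr ?_
  rw [map_mK]
  exact 𝔏.lineData.m_mem_τ

omit [IsAlgClosed K] in
/-- **`τ̃` occurs in `E` with positive coefficient.** [cite: HirschowitzIyer2010, §2 Lemma 2.2 (proof)]
[cite: Fulton1998, Def. 2.3] -/
theorem hyperplaneInter_τS_pos (hw : height w = 1) : 0 < 𝔏.hyperplaneInter (τS w (𝔏.F' : Type u) 𝔏.lineData) := by
  have hgen : (𝔏.Hm).Avoids ((𝔏.πq).left (genericPoint (𝔏.S).carrier)) := by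
    refine (𝔏.Hm_avoids_iff _).mpr fun h => ?_
    have hsp : quadricι Q ((𝔏.πq).left (genericPoint (𝔏.S).carrier)) ⤳
        quadricι Q ((𝔏.πq).left (σS w (𝔏.F' : Type u) 𝔏.lineData)) :=
      (((genericPoint_spec (𝔏.S).carrier).specializes (Set.mem_univ _)).map (𝔏.πq).left.continuous).map
        (quadricι Q).continuous
    have h' := asHomogeneousIdeal_le_of_specializes hsp h
    rw [quadricι_πq, prS_σS] at h'
    exact 𝔏.mK_notMem_w h'
  refine CartierDivisor.primeInter_pos_of_not_avoids (X := 𝔏.So) ((𝔏.isEffective_Hm).pullbackRep _ hgen)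
    (CartierDivisor.avoids_genericPoint _) ((genericPoint_spec (𝔏.S).carrier).specializes (Set.mem_univ _)) ?_ ?_
  · have h1 := height_τS w (𝔏.F' : Type u) 𝔏.lineData hw
    have h2 := height_genericPoint_surf_carrier w (𝔏.F' : Type u) 𝔏.lineData hw
    erw [h1, h2]
    rfl
  · -- `m` vanishes at `π τ̃`, so the (effective) pulled-back local equation is not a unit at `τ̃`
    intro hav
    rw [CartierDivisor.pullbackRep_of_avoids _ _ hgen] at hav
    have hne : ¬ (𝔏.Hm).Avoids ((𝔏.πq).left (τS w (𝔏.F' : Type u) 𝔏.lineData)) :=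
      fun h => ((𝔏.Hm_avoids_iff _).mp h) 𝔏.mK_mem_πq_τS
    apply hne
    obtain ⟨i, hi⟩ := ((𝔏.Hm).pullbackAvoiding (𝔏.πq).left hgen).covers (τS w (𝔏.F' : Type u) 𝔏.lineData)
    have hu := hav i hi
    rw [CartierDivisor.pullbackAvoiding_f] at hu
    exact CartierDivisor.Avoids.of_mem hi ((𝔏.isEffective_Hm i.1 _ hi).isUnitAt_of_pullbackFn hu)

/-! ### The principal divisor `[σ̃] - [τ̃]` along the generic fibre -/

omit [IsIntegral (quadric Q).left] [IsAlgClosed K] in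
/-- Prime cycles are transported by maps injective on points. [folklore] -/
theorem primeCycle_apply_toImage (a b : 𝔏.lineData.lineSub.carrier) :
    primeCycle (𝔏.lineData.lineSub.toImage (genFibι w (𝔏.F' : Type u)) a)
      (𝔏.lineData.lineSub.toImage (genFibι w (𝔏.F' : Type u)) b) = primeCycle a b := by
  haveI : IsPreimmersion (𝔏.lineData.lineSub.toImage (genFibι w (𝔏.F' : Type u))) :=
    isPreimmersion_toImage (isPullback_genFibι w (𝔏.F' : Type u)) _
  have hinj : Function.Injective (𝔏.lineData.lineSub.toImage (genFibι w (𝔏.F' : Type u))) :=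
    (𝔏.lineData.lineSub.toImage (genFibι w (𝔏.F' : Type u))).isEmbedding.injective
  by_cases h : b = a
  · subst h; rw [primeCycle_apply_self, primeCycle_apply_self]
  · rw [primeCycle_apply_of_ne h, primeCycle_apply_of_ne (hinj.ne h)]

omit [IsIntegral (quadric Q).left] [IsAlgClosed K] in
/-- **`[σ̃] - [τ̃] = [div g̃]` at the horizontal points of `S`** for some `g̃ ∈ K(S)ˣ`.
[cite: HirschowitzIyer2010, §2 Lemma 2.2 (proof)] [cite: Fulton1998, §1.3] -/
theorem exists_ord_eq_horizontal :
    ∃ g : (𝔏.S).carrier.functionField, g ≠ 0 ∧ ∀ s : (𝔏.S).carrier,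
      (CartesianMonoidalCategory.snd (projectiveSpace 8 K) 𝔏.Z).left ((𝔏.S).ι s) = genericPoint (𝔏.Z).left →
        Scheme.ord g s = (primeCycle (σS w (𝔏.F' : Type u) 𝔏.lineData) -
          primeCycle (τS w (𝔏.F' : Type u) 𝔏.lineData)) s := by
  haveI : Flat (𝔏.lineData.lineSub.toImage (genFibι w (𝔏.F' : Type u))) :=
    flat_toImage (isPullback_genFibι w (𝔏.F' : Type u)) _
  haveI : IsPreimmersion (𝔏.lineData.lineSub.toImage (genFibι w (𝔏.F' : Type u))) :=
    isPreimmersion_toImage (isPullback_genFibι w (𝔏.F' : Type u)) _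
  haveI hN : IsLocallyNoetherian (𝔏.lineData.lineSub.image (genFibι w (𝔏.F' : Type u))).carrier :=
    inferInstanceAs (IsLocallyNoetherian (𝔏.S).carrier)
  obtain ⟨g, hg0, hg⟩ := 𝔏.lineData.exists_ord_eq
  obtain ⟨g', hg'⟩ := (functionFieldMap_bijective_of_flat_of_isPreimmersion
    (𝔏.lineData.lineSub.toImage (genFibι w (𝔏.F' : Type u)))).2 g
  refine ⟨g', fun h => hg0 (by rw [← hg', h]; exact map_zero _), fun s hs => ?_⟩
  obtain ⟨y, rfl⟩ := 𝔏.exists_toImage_eq_of_horizontal hs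
  have e1 := ClosedSubvariety.divFun_ι_base (𝔏.lineData.lineSub.image (genFibι w (𝔏.F' : Type u))) g'
    (𝔏.lineData.lineSub.toImage (genFibι w (𝔏.F' : Type u)) y)
  have e2 : (𝔏.lineData.lineSub.image (genFibι w (𝔏.F' : Type u))).ι
      (𝔏.lineData.lineSub.toImage (genFibι w (𝔏.F' : Type u)) y) =
      genFibι w (𝔏.F' : Type u) (𝔏.lineData.lineSub.ι y) := (ι_apply_eq_image_ι_toImage _ _).symm
  have e3 := divFun_image_ι_apply (isPullback_genFibι w (𝔏.F' : Type u)) 𝔏.lineData.lineSub g'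
    (𝔏.lineData.lineSub.ι y)
  have e4 := ClosedSubvariety.divFun_ι_base 𝔏.lineData.lineSub g y
  rw [hg'] at e3
  rw [e2, e3, e4, ← hg y] at e1
  rw [← e1]
  simp only [Function.locallyFinsuppWithin.coe_sub, Pi.sub_apply]
  rw [show σS w (𝔏.F' : Type u) 𝔏.lineData = 𝔏.lineData.lineSub.toImage (genFibι w (𝔏.F' : Type u)) 𝔏.lineData.σ' from rfl,
    show τS w (𝔏.F' : Type u) 𝔏.lineData = 𝔏.lineData.lineSub.toImage (genFibι w (𝔏.F' : Type u)) 𝔏.lineData.τ' from rfl,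
    primeCycle_apply_toImage, primeCycle_apply_toImage]

end GenericStrongLine

end Literature.AlgebraicGeometry.Motives

end
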